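import Literature.Probability.LatticeModels.SingleSignCrossing
import Literature.Probability.LatticeModels.GoodAboveFromPinning
import Literature.Probability.LatticeModels.ShiftLemma
import Literature.Probability.Percolation.StarWindingBands
import HarnessLib

/-!
# Anchoring of the pinning structure in the single-sign case (GH2000 Lemma 5.5, Case 1)

Topic `Probability/LatticeModels`; theorems only. The pinning lemma of Georgii–Higuchi 2000
(Lemma 5.2; `PinningLemma.lean`) is applied on the event that the infinite part `J` of
`S⁺ ∩ (π_up ∖ (Δ ∪ ℓ_{≥ -m}))` touches the left half-axis unboundedly far from the origin — the event
`LeftAnchoredInf m`. In Case 3 of Lemma 5.5 this is `PinningAnchoring.ae_leftAnchoredInf`. In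
**Case 1** ("`μ(E⁺_up) = 1`, `μ(E⁻_up) = 0` … `I^{+∗}_up` touches both `ℓ_left` and `ℓ_right`
infinitely often") we prove it here without contours:

* `exists_firstFar` — cutting a `∗`-walk at its first vertex with a given property;
* `mem_starCluster_pinU_of_semicircuit` — (deterministic) a `+∗`semicircuit of `π_up` around
  `Λ_n`, `n > m`, cut at its first site of the far half-axis `ℓ_{≥ -m}`, is a `∗`-semicircuit around
  `Λ_n` lying in `U = S⁺ ∩ (π_up ∖ (Λ_m ∪ ℓ_{≥ -m}))`; an infinite `+`cluster of `{x₂ ≥ m + 1}`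
  meeting `Λ_n` must cross it (the band form of the eye lemma,
  `Percolation.exists_mem_support_of_bandSemicircuits`, with the reflected copy as the lower walk),
  so the left end of the semicircuit lies in the `∗`-component in `U` of that cluster;
* **`ae_leftAnchoredInf_of_singleSign`** — for `β > β_c(2)` and a tail-trivial `μ ∈ 𝒢(β, 0)` with
  `μ(E⁺_up) = 1`, `μ(E⁻_up) = 0`: `LeftAnchoredInf m` almost surely, for every `m` (semicircuits at
  all scales exist by `exists_starSemicircuit_of_latticeClusters_finite`, the high `+`cluster by the
  shift lemma `shift_lemma_up_level`);
* `ae_leftAnchoredInf_refl0_of_singleSign` — the same for the mirror image `ω ∘ R₀` (anchoring on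
  the right, for `PinRightPlus`).

## References

* H.-O. Georgii, Y. Higuchi, J. Math. Phys. 41 (2000) 1153–1169, Lemma 5.2 (hypothesis) and
  Lemma 5.5 (proof, Case 1) [GeorgiiHiguchi2000].
-/

noncomputable section

open MeasureTheory Filter SimpleGraph
open Literature.Probability.Percolation
open scoped ENNReal

namespace Literature.Probability.LatticeModels

/-! ### Cutting a walk at its first far vertex -/

section Cut

/-- **First vertex with a property.** A `∗`-walk ending at a vertex satisfying `Far` contains a
vertex `f` satisfying `Far` and a sub-walk to `f` all of whose other vertices do not; moreover
every non-`Far` vertex of that sub-walk is reached from the start through non-`Far` vertices of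
it. [folklore] -/
theorem exists_firstFar (Far : Site 2 → Prop) :
    ∀ {x y : Site 2} (σ : zdStarGraph.Walk x y), Far y →
      ∃ f, Far f ∧ ∃ τ : zdStarGraph.Walk x f, (∀ v ∈ τ.support, v ∈ σ.support) ∧
        (∀ v ∈ τ.support, Far v → v = f) ∧
        ∀ z ∈ τ.support, ¬ Far z → ∃ ρ : zdStarGraph.Walk x z, ∀ v ∈ ρ.support, v ∈ τ.support ∧ ¬ Far v := by
  classical
  intro x y σ
  induction σ with
  | nil =>
    intro hy
    refine ⟨_, hy, Walk.nil, fun v hv => hv, fun v hv _ => by simpa using hv, fun z hz hnz => ?_⟩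
    rw [Walk.support_nil, List.mem_singleton] at hz
    subst hz
    exact absurd hy hnz
  | cons h σ' ih =>
    rename_i u v w
    intro hy
    by_cases hu : Far u
    · refine ⟨u, hu, Walk.nil, fun z hz => ?_, fun z hz _ => by simpa using hz, fun z hz hnz => ?_⟩
      · rw [Walk.support_nil, List.mem_singleton] at hz
        subst hz; exact Walk.start_mem_support _
      · rw [Walk.support_nil, List.mem_singleton] at hz
        subst hz
        exact absurd hu hnz
    · obtain ⟨f, hf, τ', h1, h2, h3⟩ := ih hy
      refine ⟨f, hf, Walk.cons h τ', fun z hz => ?_, fun z hz hzF => ?_, fun z hz hnz => ?_⟩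
      · rw [Walk.support_cons, List.mem_cons] at hz
        rcases hz with rfl | hz
        · exact Walk.start_mem_support _
        · rw [Walk.support_cons]; exact List.mem_cons_of_mem _ (h1 z hz)
      · rw [Walk.support_cons, List.mem_cons] at hz
        rcases hz with rfl | hz
        · exact absurd hzF hu
        · exact h2 z hz hzF
      · rw [Walk.support_cons, List.mem_cons] at hz
        rcases hz with rfl | hz
        · exact ⟨Walk.nil, fun v hv => by
            rw [Walk.support_nil, List.mem_singleton] at hv
            subst hv
            exact ⟨Walk.start_mem_support _, hu⟩⟩
        · obtain ⟨ρ', hρ'⟩ := h3 z hz hnz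
          refine ⟨Walk.cons h ρ', fun v hv => ?_⟩
          rw [Walk.support_cons, List.mem_cons] at hv
          rcases hv with rfl | hv
          · exact ⟨Walk.start_mem_support _, hu⟩
          · exact ⟨by rw [Walk.support_cons]; exact List.mem_cons_of_mem _ (hρ' v hv).1, (hρ' v hv).2⟩

end Cut

/-! ### The deterministic anchoring step -/

section Det

variable {m : ℕ} {ω : SpinConfig (Site 2)}

/-- **The left end of a `+∗`semicircuit around `Λ_n`, `n > m`, lies in the `∗`-component in `U` of
any infinite `+`cluster of `{x₂ ≥ m + 1}` meeting `Λ_n`.** [cite: GeorgiiHiguchi2000, Lemma 5.5 (proof, Case 1: "`I^{+∗}_up` touches `ℓ_left` … infinitely often")] -/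
theorem mem_starCluster_pinU_of_semicircuit {n : ℕ} (hmn : m < n) {a b : ℤ} (ha : a < -(n : ℤ)) (hb : (n : ℤ) < b)
    (σ : zdStarGraph.Walk (![a, 0] : Site 2) ![b, 0]) (hσ : ∀ v ∈ σ.support, ω v = 1 ∧ 0 ≤ v 1 ∧ v ∉ box 2 n)
    {xP : Site 2} (hxP : xP ∈ box 2 n)
    (hP : (siteCluster (zdGraph 2) (spinSites 1 ω ∩ halfPlane ((m + 1 : ℕ) : ℤ)) xP).Infinite) :
    (![a, 0] : Site 2) ∈ siteCluster zdStarGraph (pinU m ω) xP := by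
  classical
  -- cut the semicircuit at its first site of the far half-axis
  set Far : Site 2 → Prop := fun v => v 1 = 0 ∧ -(m : ℤ) ≤ v 0 with hFar
  have hbFar : Far ![b, 0] := ⟨by simp, by simp; omega⟩
  obtain ⟨f, hf, τ, hτσ, hτFar, hτsub⟩ := exists_firstFar Far σ hbFar
  have hfσ : f ∈ σ.support := hτσ f (Walk.end_mem_support τ)
  obtain ⟨hf1, -, hfbox⟩ := hσ f hfσ
  have hf0 : (n : ℤ) < f 0 := by
    have h1 : ¬ (-(n : ℤ) ≤ f 0 ∧ f 0 ≤ n) := by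
      intro h
      apply hfbox
      rw [mem_box, Fin.forall_fin_two]
      exact ⟨h, by rw [hf.1]; omega⟩
    have := hf.2
    omega
  -- the reflected copy
  have hRa : reflectCoord (d := 2) 1 (![a, 0] : Site 2) = ![a, 0] := by
    funext j; rw [reflectCoord_apply]; fin_cases j <;> simp
  have hRf : reflectCoord (d := 2) 1 f = f := by
    funext j; rw [reflectCoord_apply]; fin_cases j <;> simp [hf.1]
  set τ' : zdStarGraph.Walk (![a, 0] : Site 2) f :=
    (τ.map (starReflectHom 1)).copy (by rw [starReflectHom_apply]; exact hRa) (by rw [starReflectHom_apply]; exact hRf) with hτ'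
  have hτ'supp : ∀ z ∈ τ'.support, ∃ v ∈ τ.support, z = reflectCoord 1 v := by
    intro z hz
    rw [hτ', Walk.support_copy, Walk.support_map, List.mem_map] at hz
    obtain ⟨v, hv, rfl⟩ := hz
    exact ⟨v, hv, by rw [starReflectHom_apply]⟩
  -- band avoidance
  have hτband : ∀ z ∈ τ.support, ¬ (-(n : ℤ) ≤ z 0 ∧ z 0 ≤ n ∧ z 1 ≤ n) := by
    intro z hz h
    obtain ⟨-, hz1, hzbox⟩ := hσ z (hτσ z hz)
    apply hzbox
    rw [mem_box, Fin.forall_fin_two]; omega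
  have hτ'band : ∀ z ∈ τ'.support, ¬ (-(n : ℤ) ≤ z 0 ∧ z 0 ≤ n ∧ -(n : ℤ) ≤ z 1) := by
    intro z hz h
    obtain ⟨v, hv, rfl⟩ := hτ'supp z hz
    obtain ⟨-, hv1, hvbox⟩ := hσ v (hτσ v hv)
    have hR0 : (reflectCoord (d := 2) 1 v) 0 = v 0 := Rf_apply_zero v
    have hR1 : (reflectCoord (d := 2) 1 v) 1 = -v 1 := Rf_apply_one v
    rw [hR0, hR1] at h
    apply hvbox
    rw [mem_box, Fin.forall_fin_two]; omega
  -- a box containing both walks, and an escape of the high cluster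
  obtain ⟨H, hH⟩ := exists_box_of_list (τ.support ++ τ'.support)
  obtain ⟨w, hwP, hwH⟩ := hP.exists_notMem_finset (box 2 H)
  have hxPself : xP ∈ siteCluster (zdGraph 2) (spinSites 1 ω ∩ halfPlane ((m + 1 : ℕ) : ℤ)) xP :=
    (mem_siteCluster_self_iff _ _ _).2 hP.nonempty.some_mem.1
  obtain ⟨γ, hγ⟩ := exists_walk_of_mem_siteCluster hxPself hwP
  have hxPwin : -(n : ℤ) ≤ xP 0 ∧ xP 0 ≤ n ∧ -(n : ℤ) ≤ xP 1 ∧ xP 1 ≤ n := by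
    rw [mem_box, Fin.forall_fin_two] at hxP; omega
  obtain ⟨z, hzγ, hz⟩ := exists_mem_support_of_bandSemicircuits ha hf0 (by simp) (by simp) rfl hf.1
    τ hτband τ' hτ'band (fun z hz => hH z (List.mem_append_left _ hz)) (fun z hz => hH z (List.mem_append_right _ hz))
    hxPwin hwH γ
  have hzP : z ∈ spinSites 1 ω ∩ halfPlane ((m + 1 : ℕ) : ℤ) := hγ z hzγ
  have hz1 : ((m + 1 : ℕ) : ℤ) ≤ z 1 := hzP.2
  have hzτ : z ∈ τ.support := by
    rcases hz with hz | hz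
    · exact hz
    · exfalso
      obtain ⟨v, hv, rfl⟩ := hτ'supp z hz
      obtain ⟨-, hv1, -⟩ := hσ v (hτσ v hv)
      have hR1 : (reflectCoord (d := 2) 1 v) 1 = -v 1 := Rf_apply_one v
      rw [hR1] at hz1
      push_cast at hz1; omega
  have hzFar : ¬ Far z := fun h => by rw [h.1] at hz1; push_cast at hz1; omega
  -- the sub-walk from `(a, 0)` to `z` lies in `U`
  obtain ⟨ρ, hρ⟩ := hτsub z hzτ hzFar
  have hρU : ∀ v ∈ ρ.support, v ∈ pinU m ω := by
    intro v hv
    obtain ⟨hvτ, hvFar⟩ := hρ v hv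
    obtain ⟨hv1, hv0, hvbox⟩ := hσ v (hτσ v hvτ)
    refine ⟨mem_spinSites.2 hv1, hv0, ?_⟩
    rintro (hb | hfar)
    · exact hvbox (box_mono 2 hmn.le (Finset.mem_coe.1 hb))
    · exact hvFar hfar
  -- `z` lies in the `∗`-component of the high cluster
  have hsub : spinSites 1 ω ∩ halfPlane ((m + 1 : ℕ) : ℤ) ⊆ pinU m ω := by
    rintro v ⟨hv, hv1⟩
    have hv1' : ((m + 1 : ℕ) : ℤ) ≤ v 1 := hv1
    refine ⟨hv, show (0 : ℤ) ≤ v 1 by push_cast at hv1'; omega, ?_⟩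
    rintro (hb | hfar)
    · have := (mem_box.1 (Finset.mem_coe.1 hb) 1).2
      push_cast at hv1'; omega
    · have := hfar.1
      push_cast at hv1'; omega
  have hzlat : z ∈ siteCluster (zdGraph 2) (spinSites 1 ω ∩ halfPlane ((m + 1 : ℕ) : ℤ)) xP :=
    mem_siteCluster_of_mem_support hxPself γ hγ hzγ
  have hzJ : z ∈ siteCluster zdStarGraph (pinU m ω) xP :=
    siteCluster_mono hsub xP (siteCluster_zd_subset_star _ xP hzlat)
  exact mem_siteCluster_of_walk hzJ ρ.reverse fun v hv => hρU v (by
    rw [Walk.support_reverse, List.mem_reverse] at hv; exact hv)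

/-- **Anchoring from semicircuits at all scales and a high infinite `+`cluster.** [cite: GeorgiiHiguchi2000, Lemma 5.5 (proof, Case 1)] -/
theorem leftAnchoredInf_of_semicircuits (m : ℕ)
    (hsemi : ∀ n : ℕ, ∃ (a b : ℤ) (σ : zdStarGraph.Walk (![a, 0] : Site 2) ![b, 0]), a < -(n : ℤ) ∧ (n : ℤ) < b ∧
      ∀ v ∈ σ.support, ω v = 1 ∧ 0 ≤ v 1 ∧ v ∉ box 2 n)
    {xP : Site 2} (hP : (siteCluster (zdGraph 2) (spinSites 1 ω ∩ halfPlane ((m + 1 : ℕ) : ℤ)) xP).Infinite) :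
    LeftAnchoredInf m ω := by
  classical
  obtain ⟨n₀, hn₀⟩ := exists_box_of_list [xP]
  have hxP₀ : xP ∈ box 2 n₀ := hn₀ xP (List.mem_singleton_self xP)
  set J₀ := siteCluster zdStarGraph (pinU m ω) xP with hJ₀
  -- the left ends of the semicircuits at scales `n ≥ n₁` lie in `J₀`
  have key : ∀ n : ℕ, max (m + 1) n₀ ≤ n → ∃ a : ℤ, a < -(n : ℤ) ∧ (![a, 0] : Site 2) ∈ J₀ := by
    intro n hn
    obtain ⟨a, b, σ, ha, hb, hσ⟩ := hsemi n
    refine ⟨a, ha, mem_starCluster_pinU_of_semicircuit (by omega) ha hb σ hσ (box_mono 2 (by omega) hxP₀) hP⟩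
  have hJinf : J₀.Infinite := by
    have hsub : spinSites 1 ω ∩ halfPlane ((m + 1 : ℕ) : ℤ) ⊆ pinU m ω := by
      rintro v ⟨hv, hv1⟩
      have hv1' : ((m + 1 : ℕ) : ℤ) ≤ v 1 := hv1
      refine ⟨hv, show (0 : ℤ) ≤ v 1 by push_cast at hv1'; omega, ?_⟩
      rintro (hb | hfar)
      · have := (mem_box.1 (Finset.mem_coe.1 hb) 1).2
        push_cast at hv1'; omega
      · have := hfar.1
        push_cast at hv1'; omega
    exact hP.mono ((siteCluster_zd_subset_star _ xP).trans (siteCluster_mono hsub xP))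
  obtain ⟨a₁, -, ha₁⟩ := key (max (m + 1) n₀) le_rfl
  have hcl : siteCluster zdStarGraph (pinU m ω) ![a₁, 0] = J₀ :=
    siteCluster_eq_of_mem ((mem_siteCluster_self_iff _ _ _).2 ha₁.2.1) ha₁
  refine ⟨![a₁, 0], ?_, by simp, fun N => ?_⟩
  · show (siteCluster zdStarGraph (pinU m ω) ![a₁, 0]).Infinite
    rw [hcl]; exact hJinf
  · obtain ⟨a, ha, haJ⟩ := key (max (max (m + 1) n₀) N) (le_max_left _ _)
    refine ⟨![a, 0], by rw [hcl]; exact haJ, by simp, ?_⟩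
    simp only [Matrix.cons_val_zero]
    have := le_max_right (max (m + 1) n₀) N
    omega

end Det

/-! ### Almost sure anchoring in the single-sign case -/

section AE

variable {β : ℝ} {μ : Measure (SpinConfig (Site 2))}

/-- **Anchoring in Case 1, almost surely**: for `β > β_c(2)` and a tail-trivial `μ ∈ 𝒢(β, 0)` under
which the upper half-plane contains an infinite `+`cluster but no infinite `-`cluster,
`LeftAnchoredInf m` holds almost surely for every `m`. [cite: GeorgiiHiguchi2000, Lemma 5.5 (proof, Case 1)] -/
theorem ae_leftAnchoredInf_of_singleSign (hμ : μ ∈ isingGibbsMeasures 2 β 0) (hμt : IsTailTrivial μ)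
    (hP : ∀ᵐ ω ∂μ, ∃ x, (siteCluster (zdGraph 2) (spinSites 1 ω ∩ halfPlane 0) x).Infinite)
    (hNoM : μ (existsInfClusterIn (zdGraph 2) (-1) (halfPlane 0)) = 0) (m : ℕ) :
    ∀ᵐ ω ∂μ, LeftAnchoredInf m ω := by
  classical
  filter_upwards [shift_lemma_up_level hμ hμt 1 hP (m + 1), measure_eq_zero_iff_ae_notMem.1 hNoM] with ω ⟨xP, hxP⟩ hno
  have hfin : ∀ y, (siteCluster (zdGraph 2) (spinSites (-1) ω ∩ halfPlane 0) y).Finite := by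
    intro y
    by_contra h
    exact hno ⟨y, Set.not_finite.1 h⟩
  refine leftAnchoredInf_of_semicircuits m (fun n => ?_) hxP
  have h := exists_starSemicircuit_of_latticeClusters_finite (s := 1) (ω := ω) (by simpa using hfin) n
  simpa using h

/-- **Anchoring on the right in Case 1, almost surely** (the mirror image `ω ∘ R₀`, for the pinning
event `PinRightPlus`). [cite: GeorgiiHiguchi2000, Lemma 5.5 (proof, Case 1)] -/
theorem ae_leftAnchoredInf_refl0_of_singleSign (hμ : μ ∈ isingGibbsMeasures 2 β 0) (hμt : IsTailTrivial μ)
    (hP : ∀ᵐ ω ∂μ, ∃ x, (siteCluster (zdGraph 2) (spinSites 1 ω ∩ halfPlane 0) x).Infinite)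
    (hNoM : μ (existsInfClusterIn (zdGraph 2) (-1) (halfPlane 0)) = 0) (m : ℕ) :
    ∀ᵐ ω ∂μ, LeftAnchoredInf m (refl0 ω) := by
  classical
  have hμG : IsGibbsMeasure (isingSpecification (zdGraph 2) β 0) μ := hμ
  haveI := hμG.isProbabilityMeasure
  have hρm : Measurable (refl0 : SpinConfig (Site 2) → SpinConfig (Site 2)) := measurable_refl0
  set μR : Measure (SpinConfig (Site 2)) := μ.map refl0 with hμR
  have hμRG : μR ∈ isingGibbsMeasures 2 β 0 := IsGibbsMeasure.map_configRelabel _ (reflectCoord 0) hμG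
  have hμRt : IsTailTrivial μR := hμt.map_configRelabel _
  have hφ1 : ∀ z : Site 2, ((reflectCoord (d := 2) 0) z) 1 = z 1 := fun z => (reflectCoord_zero_apply z).2
  have hP0 : (reflectCoord (d := 2) 0) ⁻¹' (halfPlane 0) = halfPlane 0 := by
    ext x; simp [halfPlane, hφ1 x]
  have hmeasE : MeasurableSet (existsInfClusterIn (zdGraph 2) (1 : ℤˣ) (halfPlane 0) : Set (SpinConfig (Site 2))) :=
    MeasurableSet.of_tailEvents (measurableSet_tailEvents_existsInfClusterIn (G := zdGraph 2) 1 (halfPlane 0))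
  have hmeasE' : MeasurableSet (existsInfClusterIn (zdGraph 2) (-1 : ℤˣ) (halfPlane 0) : Set (SpinConfig (Site 2))) :=
    MeasurableSet.of_tailEvents (measurableSet_tailEvents_existsInfClusterIn (G := zdGraph 2) (-1) (halfPlane 0))
  have hP' : ∀ᵐ ω ∂μR, ∃ x, (siteCluster (zdGraph 2) (spinSites 1 ω ∩ halfPlane 0) x).Infinite := by
    have : ∀ᵐ ω ∂μR, ω ∈ existsInfClusterIn (zdGraph 2) (1 : ℤˣ) (halfPlane 0) := by
      rw [hμR, ae_map_iff hρm.aemeasurable (p := fun ω => ω ∈ existsInfClusterIn (zdGraph 2) (1 : ℤˣ) (halfPlane 0)) hmeasE]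
      filter_upwards [hP] with ω hω
      show configRelabel (reflectCoord (d := 2) 0).toEquiv ω ∈ existsInfClusterIn (zdGraph 2) 1 (halfPlane 0)
      rw [configRelabel_mem_existsInfClusterIn_iff, hP0]
      exact hω
    exact this
  have hNoM' : μR (existsInfClusterIn (zdGraph 2) (-1) (halfPlane 0)) = 0 := by
    rw [hμR, Measure.map_apply hρm hmeasE']
    have : refl0 ⁻¹' (existsInfClusterIn (zdGraph 2) (-1 : ℤˣ) (halfPlane 0) : Set (SpinConfig (Site 2))) =
        existsInfClusterIn (zdGraph 2) (-1) (halfPlane 0) := by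
      ext ω
      show configRelabel (reflectCoord (d := 2) 0).toEquiv ω ∈ existsInfClusterIn (zdGraph 2) (-1) (halfPlane 0) ↔ _
      rw [configRelabel_mem_existsInfClusterIn_iff, hP0]
    rw [this]; exact hNoM
  have key := ae_leftAnchoredInf_of_singleSign hμRG hμRt hP' hNoM' m
  rw [hμR, ae_map_iff hρm.aemeasurable (measurableSet_leftAnchoredInf (m := m))] at key
  exact key

end AE

end Literature.Probability.LatticeModels
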